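import Literature.NumberTheory.ComplexMultiplication.CMTypeGaloisTranslateReflexField
import Literature.NumberTheory.ComplexMultiplication.QuarticCMTypes
import Literature.NumberTheory.ComplexMultiplication.QuarticCMTypesEquivalenceClasses
import HarnessLib

/-!
# Galois classes of the CM types of a QUARTIC CM field: one for a non-Galois field (two Streng classes), two for
# a biquadratic field, one for a cyclic field (Streng 2010 Lemma I.3.4 with Shimura 1998 §8.3 Prop. 28); the reflex
# field is an isogeny invariant of simple CM points

Layer `Literature/NumberTheory/ComplexMultiplication`, namespace `Literature.NumberTheory.ComplexMultiplication` (lane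
`lit-hodgefound`, Track 2 foundations, Layer A3; seat `lit-hodgefound-p11`, generation 24, row g24-#8).  Sequel of
`CMTypeGaloisEquivalence` (g24-#5: `cmTypeGaloisSetoid K`), `CMTypeGaloisClassReflexDegree` (g24-#6: the Galois class
of `Φ` has `[ℚ(tr_Φ) : ℚ]` members) and `CMTypeGaloisTranslateReflexField` (g24-#7), with the tree's quartic files
`QuarticCMTypes` (Streng Lemma I.3.4 / Shimura §8.4 Ex. (2): `isPrimitive_of_not_isGalois`,
`finrank_traceField_eq_four_of_isPrimitive`, `finrank_traceField_eq_two_of_not_isCyclic`) and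
`QuarticCMTypesEquivalenceClasses` / `CMTypeEquivalenceClassesCount` (g23-#3 / g24-#1: the Streng classes `{Φ, Φ̄}`,
`{Φ′, Φ̄′}` of a non-Galois quartic field, `card_classes_eq_two_of_finrank_eq_four_of_not_isGalois`).  THEOREMS ONLY;
no definition, no named fact (D-0026).

THE PRINT.  M. Streng, *Complex multiplication of abelian surfaces* (2010), Ch. I Lemma 3.4, p. 21 (held text
`paper:w3149246750` p0022): for a quartic CM field `K` — (1) `K/ℚ` biquadratic: every CM type is induced from an
imaginary quadratic subfield (whose image is then the reflex field); (2) `K/ℚ` cyclic: «all four CM-types are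
equivalent» and primitive, reflex field `≅ K`; (3) `K/ℚ` not normal: all four CM types are primitive, they form the
two classes `{Φ, Φ̄}`, `{Φ′, Φ̄′}`, and the reflex field is a non-normal quartic field (degree `4`, Shimura §8.4
Ex. (2) (B), (C)).  G. Shimura (1998) §8.3 Prop. 28: `[K* : ℚ] = [G : H*]`, `H* = {γ | γΦ = Φ}` — the reflex degree is
the number of Galois translates (g24-#6).  B. Dina, S. Ionica, J. Sijsling (2022) §1.2 Def. 8 (Galois equivalence)
and Props. 11–12 (for non-normal SEXTIC fields Galois equivalence is strictly coarser than equivalence: `4 ↦ 2`,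
`4 ↦ 1` classes); the quartic non-normal field is the smallest instance of that phenomenon: `2 ↦ 1`.

WHAT IS PROVED.
* §1 (any CM field `K`) **`card_cmTypeGaloisClasses_mul_eq_two_pow_of_forall`**: if every CM type of `K` has reflex
  degree `m`, then `#{Galois classes} · m = 2^g` (every Galois class has `m` members, g24-#6);
  **`SiegelCMPoint.IsCMPointOf.traceField_cmType_eq_of_isIsogenous_of_isSimple`**: for EVERY CM field `K` of degree
  `2n` and CM points `Z, Z′ ∈ 𝔥_n` of `K` with `X_{Z′}` simple, `X_Z ∼ X_{Z′} ⟹ ℚ(tr_{Φ_Z}) = ℚ(tr_{Φ_{Z′}})` — the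
  reflex field is an isogeny invariant of simple CM points (Streng Lemma I.5.6 `Φ_Z = Φ_{Z′}σ` + `traceField_twist`;
  g24-#7 had the abelian case), and the torus-level form `IsCMTorusRat.traceField_cmType_eq_of_isIsogenous`.
* §2 quartic `K` (`[K : ℚ] = 4`, CM points on `𝔥₂`):
  - NOT Galois: **`card_cmTypeGaloisClasses_eq_one_of_not_isGalois`** (ONE Galois class: all four types are Galois
    equivalent, `cmTypeGaloisSetoid_r_of_not_isGalois`) versus TWO Streng classes
    (`card_classes_eq_two_of_finrank_eq_four_of_not_isGalois`), so **`cmTypeGaloisSetoid_ne_of_not_isGalois` :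
    `cmTypeGaloisSetoid K ≠ cmTypeEquivSetoid K`** and `exists_galoisRel_not_rel_of_not_isGalois` (Galois-equivalent,
    non-equivalent types exist);
  - biquadratic: **`card_cmTypeGaloisClasses_eq_two_of_not_isCyclic`** and, Galois classes being Streng classes for
    an abelian field (g24-#5), **`card_classes_eq_two_of_not_isCyclic`** (TWO Streng classes);
  - cyclic: one Galois class is g24-#5's `card_cmTypeGaloisClasses_eq_one_of_finrank_eq_four` (not restated).

## References

* [Streng2010] M. Streng, *Complex multiplication of abelian surfaces*, thesis, Leiden (2010), Ch. I Lemma 3.4 (p. 21),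
  §4 (p. 22), Lemma 5.6 (p. 26).
* [Shimura1998] G. Shimura, *Abelian Varieties with Complex Multiplication and Modular Functions* (1998), §8.3
  Prop. 28; §8.4 Example (2).
* [DinaIonicaSijsling2022] B. Dina, S. Ionica, J. Sijsling, Math. Comp. 91 (2022), §1.2 Def. 8, Prop. 7, Props. 11–12.

## Provenance

Lane `lit-hodgefound` (HOME `run/shared/lean/pub/lit-hodgefound/`), prover seat `lit-hodgefound-p11` (gen 24),
self-proposed row g24-#8 (INBOX claim 2026-08-27, l.40105).
-/

set_option autoImplicit false

noncomputable section

open scoped Classical NumberField Pointwise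
open NumberField Module IntermediateField

namespace Literature.NumberTheory.ComplexMultiplication

open Literature.AlgebraicGeometry.Motives (CMType)
open Literature.AlgebraicGeometry.Motives.HodgeStructure (cmTypeSmul cmTypeSmul_val)

variable {K : Type} [Field K] [NumberField K] [IsCMField K]

/-! ## §1 Two general facts -/

section General

/-- **If every CM type of `K` has reflex degree `m`, then `#{Galois classes} · m = 2^g`** — every Galois class has
exactly `m = [K* : ℚ]` members (g24-#6 `natCard_galoisClass_eq_finrank_traceField`) and there are `2^g` types.
[cite: Shimura1998, §8.3 Prop. 28] [cite: DinaIonicaSijsling2022, §1.2 Prop. 7 and Def. 8] -/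
theorem card_cmTypeGaloisClasses_mul_eq_two_pow_of_forall (m : ℕ) (h : ∀ Φ : CMType K, finrank ℚ (traceField Φ) = m) :
    Nat.card (Quotient (cmTypeGaloisSetoid K)) * m = 2 ^ (finrank ℚ K / 2) := by
  classical
  haveI : Finite (CMType K) := finite_cmType
  letI : Fintype (CMType K) := Fintype.ofFinite _
  -- `CMType K ≃ Σ q, {Φ // ⟦Φ⟧ = q}` and every fibre has `m` elements
  let e : CMType K ≃ Σ q : Quotient (cmTypeGaloisSetoid K), {Φ : CMType K // Quotient.mk (cmTypeGaloisSetoid K) Φ = q} :=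
    { toFun := fun Φ => ⟨Quotient.mk _ Φ, ⟨Φ, rfl⟩⟩
      invFun := fun x => x.2.1
      left_inv := fun Φ => rfl
      right_inv := fun x => by
        obtain ⟨q, ⟨Φ, hΦ⟩⟩ := x
        subst hΦ
        rfl }
  have hfib : ∀ q : Quotient (cmTypeGaloisSetoid K),
      Nat.card {Φ : CMType K // Quotient.mk (cmTypeGaloisSetoid K) Φ = q} = m := by
    intro q
    obtain ⟨Φ₀, rfl⟩ := Quotient.exists_rep q
    rw [← h Φ₀, ← natCard_galoisClass_eq_finrank_traceField Φ₀]
    refine Nat.card_congr (Equiv.subtypeEquivRight fun Ψ => ?_)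
    rw [eq_comm, cmTypeGaloisClass_eq_iff]
  rw [← CMTypeCount.natCard_cmType, Nat.card_congr e, Nat.card_sigma, Finset.sum_congr rfl fun q _ => hfib q,
    Finset.sum_const, smul_eq_mul, Finset.card_univ, Nat.card_eq_fintype_card]

end General

section Siegel

open Literature.NumberTheory.Automorphic (siegelUpperHalfSpace)
open Literature.AlgebraicGeometry.ModuliOfAbelianVarieties.SiegelModuli (prinPeriod)
open Literature.Geometry.Kaehler.ComplexTorus (IsIsogenous IsSimple)

variable {g : ℕ} {Z Z' : siegelUpperHalfSpace g} {h h' : K →ₐ[ℚ] Matrix (Fin g ⊕ Fin g) (Fin g ⊕ Fin g) ℚ}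

/-- **THE REFLEX FIELD IS AN ISOGENY INVARIANT OF SIMPLE CM POINTS, for every CM field `K`**: if `Z, Z′ ∈ 𝔥_n` are CM
points of `K` (`[K : ℚ] = 2n`), `X_{Z′}` is simple and `X_Z ∼ X_{Z′}`, then `ℚ(tr_{Φ_Z}) = ℚ(tr_{Φ_{Z′}})` — Lemma I.5.6
gives `Φ_Z = Φ_{Z′}σ`, and equivalent types have the same reflex field (`traceField_twist`).
[cite: Streng2010, Ch. I §4, p. 22 and Lemma 5.6, p. 26] [cite: Shimura1998, §8.3 Prop. 28] -/
theorem SiegelCMPoint.IsCMPointOf.traceField_cmType_eq_of_isIsogenous_of_isSimple (hK : finrank ℚ K = 2 * g)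
    (hZ : SiegelCMPoint.IsCMPointOf h Z) (hZ' : SiegelCMPoint.IsCMPointOf h' Z') (hS : IsSimple (prinPeriod Z'))
    (hiso : IsIsogenous (prinPeriod Z) (prinPeriod Z')) : traceField (hZ.cmType hK) = traceField (hZ'.cmType hK) := by
  obtain ⟨σ, hσ⟩ := (hZ.isIsogenous_iff_exists_cmType_eq_twist hK hZ' hS).1 hiso
  rw [hσ, traceField_twist]

/-- The same with `X_Z` simple. [cite: Streng2010, Ch. I §4, p. 22 and Lemma 5.6, p. 26] [cite: Shimura1998, §8.3 Prop. 28] -/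
theorem SiegelCMPoint.IsCMPointOf.traceField_cmType_eq_of_isIsogenous_of_isSimple' (hK : finrank ℚ K = 2 * g)
    (hZ : SiegelCMPoint.IsCMPointOf h Z) (hZ' : SiegelCMPoint.IsCMPointOf h' Z') (hS : IsSimple (prinPeriod Z))
    (hiso : IsIsogenous (prinPeriod Z) (prinPeriod Z')) : traceField (hZ.cmType hK) = traceField (hZ'.cmType hK) := by
  obtain ⟨σ, hσ⟩ := (hZ.isIsogenous_iff_exists_cmType_eq_twist' hK hZ' hS).1 hiso
  rw [hσ, traceField_twist]

/-- Contrapositive: simple CM points with different reflex fields are not isogenous.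
[cite: Streng2010, Ch. I Lemma 5.6, p. 26] [cite: Shimura1998, §8.3 Prop. 28] -/
theorem SiegelCMPoint.IsCMPointOf.not_isIsogenous_of_traceField_cmType_ne (hK : finrank ℚ K = 2 * g)
    (hZ : SiegelCMPoint.IsCMPointOf h Z) (hZ' : SiegelCMPoint.IsCMPointOf h' Z') (hS : IsSimple (prinPeriod Z'))
    (hne : traceField (hZ.cmType hK) ≠ traceField (hZ'.cmType hK)) : ¬ IsIsogenous (prinPeriod Z) (prinPeriod Z') :=
  fun hiso => hne (hZ.traceField_cmType_eq_of_isIsogenous_of_isSimple hK hZ' hS hiso)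

end Siegel

/-! ## §2 Quartic CM fields -/

section Quartic

/-- **NON-GALOIS quartic CM field: every CM type has reflex degree `4`** (all four types are primitive, Streng Lemma
3.4 (3); Shimura §8.4 Ex. (2) (B), (C): the reflex field is a quartic field).
[cite: Streng2010, Ch. I Lemma 3.4 (3), p. 21] [cite: Shimura1998, §8.4 Example (2)] -/
theorem finrank_traceField_eq_four_of_not_isGalois (h4 : finrank ℚ K = 4) (hKG : ¬ IsGalois ℚ K) (Φ : CMType K) :
    finrank ℚ (traceField Φ) = 4 := by
  obtain ⟨φ₀⟩ := (inferInstance : Nonempty (K →+* ℂ))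
  exact finrank_traceField_eq_four_of_isPrimitive h4 (isPrimitive_of_not_isGalois h4 hKG Φ φ₀)

/-- **NON-GALOIS quartic CM field: exactly ONE Galois class — all four CM types are Galois equivalent**
(`#{classes} · 4 = 2² = 4`). [cite: Streng2010, Ch. I Lemma 3.4 (3), p. 21] [cite: DinaIonicaSijsling2022, §1.2 Def. 8]
[cite: Shimura1998, §8.3 Prop. 28] -/
theorem card_cmTypeGaloisClasses_eq_one_of_not_isGalois (h4 : finrank ℚ K = 4) (hKG : ¬ IsGalois ℚ K) :
    Nat.card (Quotient (cmTypeGaloisSetoid K)) = 1 := by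
  have h := card_cmTypeGaloisClasses_mul_eq_two_pow_of_forall 4 (finrank_traceField_eq_four_of_not_isGalois h4 hKG)
  rw [h4] at h
  norm_num at h
  omega

/-- Non-Galois quartic: any two CM types are Galois equivalent. [cite: Streng2010, Ch. I Lemma 3.4 (3), p. 21]
[cite: DinaIonicaSijsling2022, §1.2 Def. 8] -/
theorem cmTypeGaloisSetoid_r_of_not_isGalois (h4 : finrank ℚ K = 4) (hKG : ¬ IsGalois ℚ K) (Φ Ψ : CMType K) :
    (cmTypeGaloisSetoid K).r Φ Ψ := by
  haveI : Finite (CMType K) := finite_cmType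
  haveI : Subsingleton (Quotient (cmTypeGaloisSetoid K)) :=
    (Nat.card_eq_one_iff_unique.1 (card_cmTypeGaloisClasses_eq_one_of_not_isGalois h4 hKG)).1
  exact Quotient.exact (Subsingleton.elim (Quotient.mk (cmTypeGaloisSetoid K) Φ) (Quotient.mk _ Ψ))

/-- **Non-Galois quartic: Galois equivalence is STRICTLY coarser than Streng's equivalence** (one Galois class, two
classes `{Φ, Φ̄}`, `{Φ′, Φ̄′}`): the two setoids differ.  (The smallest instance of the phenomenon of DIS Props. 11–12.)
[cite: Streng2010, Ch. I Lemma 3.4 (3), p. 21] [cite: DinaIonicaSijsling2022, §1.2 Def. 8 and Props. 11–12] -/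
theorem cmTypeGaloisSetoid_ne_of_not_isGalois (h4 : finrank ℚ K = 4) (hKG : ¬ IsGalois ℚ K) :
    cmTypeGaloisSetoid K ≠ cmTypeEquivSetoid K := by
  intro heq
  have h1 := card_cmTypeGaloisClasses_eq_one_of_not_isGalois h4 hKG
  rw [heq, card_classes_eq_two_of_finrank_eq_four_of_not_isGalois h4 hKG] at h1
  exact absurd h1 (by norm_num)

/-- Non-Galois quartic: there are Galois-equivalent CM types which are NOT equivalent (e.g. `Φ` and `Φ′ ∉ {Φ, Φ̄}`).
[cite: Streng2010, Ch. I Lemma 3.4 (3), p. 21] [cite: DinaIonicaSijsling2022, §1.2 Def. 8 and Props. 11–12] -/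
theorem exists_galoisRel_not_rel_of_not_isGalois (h4 : finrank ℚ K = 4) (hKG : ¬ IsGalois ℚ K) :
    ∃ Φ Ψ : CMType K, (cmTypeGaloisSetoid K).r Φ Ψ ∧ ¬ (cmTypeEquivSetoid K).r Φ Ψ := by
  by_contra hall
  push Not at hall
  apply cmTypeGaloisSetoid_ne_of_not_isGalois h4 hKG
  refine Setoid.ext fun Φ Ψ => ⟨hall Φ Ψ, fun hr => ?_⟩
  obtain ⟨σ, rfl⟩ := hr
  rcases (equiv_iff_eq_or_eq_bar_of_natCard_aut_eq_two (natCard_algEquiv_eq_two_of_not_isGalois h4 hKG) Φ _).1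
      ⟨σ, rfl⟩ with he | he
  · simpa only [he] using (cmTypeGaloisSetoid K).refl Φ
  · simpa only [he] using cmTypeGaloisSetoid_r_bar Φ

/-- Non-Galois quartic: the Galois class of a type is all of `CMType K` (four members), its Streng class has two.
[cite: Streng2010, Ch. I Lemma 3.4 (3), p. 21] [cite: Shimura1998, §8.3 Prop. 28] -/
theorem natCard_galoisClass_eq_four_of_not_isGalois (h4 : finrank ℚ K = 4) (hKG : ¬ IsGalois ℚ K) (Φ : CMType K) :
    Nat.card {Ψ : CMType K // ∃ τ : ℂ ≃+* ℂ, Ψ = cmTypeSmul τ Φ} = 4 := by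
  rw [natCard_galoisClass_eq_finrank_traceField, finrank_traceField_eq_four_of_not_isGalois h4 hKG]

/-- **BIQUADRATIC quartic CM field: exactly TWO Galois classes** (every type is induced from an imaginary quadratic
subfield, its reflex field, of degree `2`: `#{classes} · 2 = 4`). [cite: Streng2010, Ch. I Lemma 3.4 (1), p. 21]
[cite: Shimura1998, §8.4 Example (2) (A) and §8.3 Prop. 28] [cite: DinaIonicaSijsling2022, §1.2 Def. 8] -/
theorem card_cmTypeGaloisClasses_eq_two_of_not_isCyclic [IsGalois ℚ K] (h4 : finrank ℚ K = 4)
    (hG : ¬ IsCyclic (K ≃ₐ[ℚ] K)) : Nat.card (Quotient (cmTypeGaloisSetoid K)) = 2 := by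
  have h := card_cmTypeGaloisClasses_mul_eq_two_pow_of_forall 2 (finrank_traceField_eq_two_of_not_isCyclic h4 hG)
  rw [h4] at h
  norm_num at h
  omega

/-- A group of order `4` is commutative. [folklore] -/
private theorem mul_comm_of_card_eq_four {G : Type*} [Group G] (hG : Nat.card G = 4) (a b : G) : a * b = b * a := by
  haveI : Fact (Nat.Prime 2) := ⟨Nat.prime_two⟩
  letI : CommGroup G := IsPGroup.commGroupOfCardEqPrimeSq (p := 2) (by rw [hG]; norm_num)
  exact mul_comm a b

/-- **Biquadratic quartic CM field: exactly TWO classes of CM types in Streng's sense** (`{Φ₁, Φ̄₁}`, `{Φ₂, Φ̄₂}`, the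
types induced from the two imaginary quadratic subfields) — Galois classes are Streng classes for an abelian field
(g24-#5). [cite: Streng2010, Ch. I Lemma 3.4 (1), p. 21] [cite: Shimura1998, §8.4 Example (2) (A)] -/
theorem card_classes_eq_two_of_not_isCyclic [IsGalois ℚ K] (h4 : finrank ℚ K = 4) (hG : ¬ IsCyclic (K ≃ₐ[ℚ] K)) :
    Nat.card (Quotient (cmTypeEquivSetoid K)) = 2 := by
  have hcard : Nat.card (K ≃ₐ[ℚ] K) = 4 := by rw [IsGalois.card_aut_eq_finrank, h4]
  rw [← cmTypeGaloisSetoid_eq_cmTypeEquivSetoid (mul_comm_of_card_eq_four hcard)]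
  exact card_cmTypeGaloisClasses_eq_two_of_not_isCyclic h4 hG

/-- Biquadratic: every Galois class (= class) has exactly two members, `{Φ, Φ̄}`. [cite: Streng2010, Ch. I Lemma 3.4 (1), p. 21]
[cite: Shimura1998, §8.3 Prop. 28] -/
theorem natCard_galoisClass_eq_two_of_not_isCyclic [IsGalois ℚ K] (h4 : finrank ℚ K = 4)
    (hG : ¬ IsCyclic (K ≃ₐ[ℚ] K)) (Φ : CMType K) :
    Nat.card {Ψ : CMType K // ∃ τ : ℂ ≃+* ℂ, Ψ = cmTypeSmul τ Φ} = 2 := by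
  rw [natCard_galoisClass_eq_finrank_traceField, finrank_traceField_eq_two_of_not_isCyclic h4 hG]

/-- **The quartic trichotomy for Galois classes**: `1` (cyclic), `2` (biquadratic), `1` (non-Galois) — in particular a
quartic CM field has at most two Galois classes of CM types. [cite: Streng2010, Ch. I Lemma 3.4, p. 21]
[cite: DinaIonicaSijsling2022, §1.2 Def. 8] -/
theorem card_cmTypeGaloisClasses_le_two_of_finrank_eq_four (h4 : finrank ℚ K = 4) :
    Nat.card (Quotient (cmTypeGaloisSetoid K)) ≤ 2 := by
  by_cases hKG : IsGalois ℚ K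
  · by_cases hG : IsCyclic (K ≃ₐ[ℚ] K)
    · rw [card_cmTypeGaloisClasses_eq_one_of_finrank_eq_four hG h4]
      norm_num
    · rw [card_cmTypeGaloisClasses_eq_two_of_not_isCyclic h4 hG]
  · rw [card_cmTypeGaloisClasses_eq_one_of_not_isGalois h4 hKG]
    norm_num

end Quartic

end Literature.NumberTheory.ComplexMultiplication
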